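import Mathlib
import Literature.Analysis.FluidPDE.NSViscosityRescaling
import Literature.Analysis.FluidPDE.TaoLocalisation
import Summits.NavierStokesRegularity.NavierStokesRegularity.Theses.SlicedKelvin

/-!
# Crux `SlicedKelvin.FluxZoom` (stmt-NavierStokesRegularity-15603), line `registered`,
# stub `stub_viscosityNormalization`: reduction of the blow-up zoom to unit viscosity

Support file (theorems only, `--supports stmt-NavierStokesRegularity-15603`) for the lead's
skeleton of the crux `FluxZoom` of route `SlicedKelvin`. The lead proves the vorticity-record zoom
at bounded planar flux for viscosity `ν = 1` (`stub_zoomCoreUnit`); this file proves that the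
unit-viscosity statement implies the statement for every `ν > 0`, by Tao's viscosity rescaling
(Tao 2013, footnote 3)

  `ũ(s, x) = ν⁻¹ u(ν⁻¹ s, x)`, `p̃(s, x) = ν⁻² p(ν⁻¹ s, x)` on `[0, νT) × ℝ³`,

i.e. `ũ = timeRescale ν⁻¹ ν⁻¹ u`, `p̃ = timeRescale ν⁻¹ ν⁻² p`
(`Literature.Analysis.FluidPDE.NSViscosityRescaling`). The bookkeeping:

1. `(ũ, p̃)` is a classical solution with viscosity `1` on `[0, νT)`
   (`IsClassicalNSSolutionOn.viscosityRescale_set` with `S' = [0, νT)`, `S = [0, T)`);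
2. the Leray–Hopf energy inequality bounds `∫ |ũ(s)|² = ν⁻² ∫ |u(ν⁻¹ s)|² ≤ ν⁻² · 2E(u 0)`
   uniformly on `[0, νT)` (`IsLerayHopfOn.lintegral_enorm_sq_le`, `lintegral_enorm_sq_const_smul`);
3. `curl ũ(s) = ν⁻¹ curl u(ν⁻¹ s)` (`curl_const_smul_eq`), so the unsigned planar flux bound `M`
   becomes `ν⁻¹ M`, the sub-slab bounds `B` on `[0, T']` become `ν⁻¹ B` on `[0, νT']`, and the
   vorticity of `ũ` is unbounded on `[0, νT)` iff that of `u` is unbounded on `[0, T)`.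

The conclusion of the zoom (a bounded ancient mild solution with viscosity `1`, non-constant on a
negative slice) does not mention `u`, `ν`, `T`, so no transport back is needed.

No named fact is assumed: every ingredient is a theorem of Mathlib or of the tree.

## References

* T. Tao, *Localisation and compactness properties of the Navier–Stokes global regularity
  problem*, Anal. PDE 6 (2013) 25–107, footnote 3 (the rescaling to `ν = 1`) [Tao2011].
* J. Leray, *Sur le mouvement d'un liquide visqueux emplissant l'espace*, Acta Math. 63 (1934),
  (5.2) (energy inequality) [Leray1934].
-/

noncomputable section

-- the summit and its single sub-problem share the name (CONVENTIONS §1), as in every Theorems file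
set_option linter.dupNamespace false

open MeasureTheory InnerProductSpace Set
open scoped ENNReal RealInnerProductSpace

namespace Summit.NavierStokesRegularity.NavierStokesRegularity.Theorems.FluxZoom.Registered

open Literature.Analysis.FluidPDE

/-! ### The time change `s ↦ ν⁻¹ s` on half-open intervals -/

/-- `s ↦ ν⁻¹ s` maps `[0, νT)` into `[0, T)` for `ν > 0` (the half-open analogue of the tree's
`mapsTo_inv_mul_Icc`). -/
private theorem mapsTo_inv_mul_Ico {ν T : ℝ} (hν : 0 < ν) :
    MapsTo (fun s => ν⁻¹ * s) (Ico 0 (ν * T)) (Ico 0 T) := by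
  intro s hs
  refine ⟨mul_nonneg (inv_nonneg.2 hν.le) hs.1, ?_⟩
  calc ν⁻¹ * s < ν⁻¹ * (ν * T) := mul_lt_mul_of_pos_left hs.2 (inv_pos.2 hν)
    _ = T := by rw [← mul_assoc, inv_mul_cancel₀ hν.ne', one_mul]

/-- `ν⁻¹ (ν t) = t` for `ν ≠ 0`. -/
private theorem inv_mul_mul_self {ν : ℝ} (hν : ν ≠ 0) (t : ℝ) : ν⁻¹ * (ν * t) = t := by
  rw [← mul_assoc, inv_mul_cancel₀ hν, one_mul]

/-! ### The rescaled solution `ũ = ν⁻¹ u(ν⁻¹ ·)` on `[0, νT)` -/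

section Rescale

variable {ν T : ℝ} {u : ℝ → EuclideanSpace ℝ (Fin 3) → EuclideanSpace ℝ (Fin 3)}
  {p : ℝ → EuclideanSpace ℝ (Fin 3) → ℝ}

/-- **(1) Classical solution.** The viscosity rescaling of an unforced classical solution with
viscosity `ν > 0` on `[0, T) × ℝ³` is an unforced classical solution with viscosity `1` on
`[0, νT) × ℝ³` (Tao 2013, footnote 3; `IsClassicalNSSolutionOn.viscosityRescale_set`). -/
private theorem isClassical_timeRescale_Ico
    (h : IsClassicalNSSolutionOn (Ico 0 T) ν 0 u p) (hν : 0 < ν) :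
    IsClassicalNSSolutionOn (Ico 0 (ν * T)) 1 0 (timeRescale ν⁻¹ ν⁻¹ u)
      (timeRescale ν⁻¹ (ν⁻¹ ^ 2) p) := by
  simpa using
    h.viscosityRescale_set hν.ne' (mapsTo_inv_mul_Ico hν) (uniqueDiffOn_Ico 0 (ν * T))

/-- **(2) Uniform energy bound.** By the Leray–Hopf energy inequality,
`∫ |ũ(s)|² = ν⁻² ∫ |u(ν⁻¹ s)|² ≤ ν⁻² · 2E(u 0) < ∞` for `s ∈ [0, νT)`. -/
private theorem energy_timeRescale_Ico (hν : 0 < ν) (hLH : IsLerayHopfOn T ν 0 (u 0) u) :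
    ∃ K : ℝ≥0∞, K < ⊤ ∧
      ∀ s ∈ Ico 0 (ν * T), ∫⁻ x, ‖timeRescale ν⁻¹ ν⁻¹ u s x‖ₑ ^ 2 ≤ K := by
  refine ⟨ENNReal.ofReal (ν⁻¹ ^ 2) * ENNReal.ofReal (2 * VectorCalculus.kineticEnergy (u 0)),
    ENNReal.mul_lt_top ENNReal.ofReal_lt_top ENNReal.ofReal_lt_top, fun s hs => ?_⟩
  simp only [timeRescale_apply]
  rw [lintegral_enorm_sq_const_smul]
  gcongr
  exact hLH.lintegral_enorm_sq_le hν.le (Ico_subset_Icc_self (mapsTo_inv_mul_Ico hν hs))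

/-- **(3a) Vorticity.** `curl ũ(s) = ν⁻¹ curl u(ν⁻¹ s)` for `s ∈ [0, νT)` (the slice
`u(ν⁻¹ s)` is smooth, `curl_const_smul_eq`). -/
private theorem curl_timeRescale_Ico (h : IsClassicalNSSolutionOn (Ico 0 T) ν 0 u p) (hν : 0 < ν)
    {s : ℝ} (hs : s ∈ Ico 0 (ν * T)) :
    curl (timeRescale ν⁻¹ ν⁻¹ u s) = fun x => ν⁻¹ • curl (u (ν⁻¹ * s)) x := by
  rw [timeRescale_slice]
  exact curl_const_smul_eq
    ((h.contDiff_velocity (mapsTo_inv_mul_Ico hν hs)).differentiable (by simp)) _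

/-- **(3b) Planar flux.** If the unsigned flux of `curl u(t)` through every plane is `≤ M` for
`t ∈ [0, T)`, then that of `curl ũ(s)` is `≤ ν⁻¹ M` for `s ∈ [0, νT)`. -/
private theorem flux_timeRescale_Ico (h : IsClassicalNSSolutionOn (Ico 0 T) ν 0 u p) (hν : 0 < ν)
    {M : ℝ}
    (hM : ∀ t ∈ Ico 0 T,
      ∀ (R : EuclideanSpace ℝ (Fin 3) ≃ₗᵢ[ℝ] EuclideanSpace ℝ (Fin 3)) (c : ℝ),
        ∫⁻ y : EuclideanSpace ℝ (Fin 2),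
          ‖⟪curl (u t) (R (WithLp.toLp 2 ![y 0, y 1, c])), R (EuclideanSpace.single 2 1)⟫‖ₑ ≤
            ENNReal.ofReal M) :
    ∀ s ∈ Ico 0 (ν * T),
      ∀ (R : EuclideanSpace ℝ (Fin 3) ≃ₗᵢ[ℝ] EuclideanSpace ℝ (Fin 3)) (c : ℝ),
        ∫⁻ y : EuclideanSpace ℝ (Fin 2),
          ‖⟪curl (timeRescale ν⁻¹ ν⁻¹ u s) (R (WithLp.toLp 2 ![y 0, y 1, c])),
            R (EuclideanSpace.single 2 1)⟫‖ₑ ≤ ENNReal.ofReal (ν⁻¹ * M) := by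
  intro s hs R c
  have hν' : 0 ≤ ν⁻¹ := inv_nonneg.2 hν.le
  rw [curl_timeRescale_Ico h hν hs]
  simp only [real_inner_smul_left, enorm_mul, Real.enorm_eq_ofReal hν']
  rw [lintegral_const_mul' _ _ ENNReal.ofReal_ne_top, ENNReal.ofReal_mul hν']
  gcongr
  exact hM _ (mapsTo_inv_mul_Ico hν hs) R c

/-- **(4) Sub-slab bounds.** If velocity and vorticity of `u` are bounded on every closed sub-slab
`[0, T'] × ℝ³`, `0 < T' < T`, then so are those of `ũ` on every `[0, T̃'] × ℝ³`, `0 < T̃' < νT`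
(with `T' = ν⁻¹ T̃'` and the bound `ν⁻¹ B`). -/
private theorem subslab_timeRescale_Ico (h : IsClassicalNSSolutionOn (Ico 0 T) ν 0 u p)
    (hν : 0 < ν)
    (hsub : ∀ T' ∈ Ioo 0 T, ∃ B : ℝ, ∀ t ∈ Icc 0 T', ∀ x, ‖u t x‖ ≤ B ∧ ‖curl (u t) x‖ ≤ B) :
    ∀ T' ∈ Ioo 0 (ν * T), ∃ B : ℝ, ∀ s ∈ Icc 0 T', ∀ x,
      ‖timeRescale ν⁻¹ ν⁻¹ u s x‖ ≤ B ∧ ‖curl (timeRescale ν⁻¹ ν⁻¹ u s) x‖ ≤ B := by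
  intro T' hT'
  have hT'' : ν⁻¹ * T' ∈ Ioo 0 T := (inv_mul_mem_Ioo_iff hν).2 hT'
  obtain ⟨B, hB⟩ := hsub (ν⁻¹ * T') hT''
  have hν' : 0 ≤ ν⁻¹ := inv_nonneg.2 hν.le
  refine ⟨ν⁻¹ * B, fun s hs x => ?_⟩
  have ht : ν⁻¹ * s ∈ Icc 0 (ν⁻¹ * T') :=
    ⟨mul_nonneg hν' hs.1, mul_le_mul_of_nonneg_left hs.2 hν'⟩
  have hs' : s ∈ Ico 0 (ν * T) := ⟨hs.1, hs.2.trans_lt hT'.2⟩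
  obtain ⟨h1, h2⟩ := hB _ ht x
  refine ⟨?_, ?_⟩
  · rw [timeRescale_apply, norm_smul, Real.norm_of_nonneg hν']
    exact mul_le_mul_of_nonneg_left h1 hν'
  · rw [curl_timeRescale_Ico h hν hs', norm_smul, Real.norm_of_nonneg hν']
    exact mul_le_mul_of_nonneg_left h2 hν'

/-- **(5) Unbounded vorticity.** If the vorticity of `u` is unbounded on `[0, T) × ℝ³` then the
vorticity of `ũ` is unbounded on `[0, νT) × ℝ³` (`curl u(t) = ν curl ũ(νt)`). -/
private theorem unbounded_timeRescale_Ico (h : IsClassicalNSSolutionOn (Ico 0 T) ν 0 u p)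
    (hν : 0 < ν) (hunb : ¬ ∃ W : ℝ, ∀ t ∈ Ico 0 T, ∀ x, ‖curl (u t) x‖ ≤ W) :
    ¬ ∃ W : ℝ, ∀ s ∈ Ico 0 (ν * T), ∀ x, ‖curl (timeRescale ν⁻¹ ν⁻¹ u s) x‖ ≤ W := by
  rintro ⟨W, hW⟩
  refine hunb ⟨ν * W, fun t ht x => ?_⟩
  have hs : ν * t ∈ Ico 0 (ν * T) := ⟨mul_nonneg hν.le ht.1, mul_lt_mul_of_pos_left ht.2 hν⟩
  have hWs := hW _ hs x
  rw [curl_timeRescale_Ico h hν hs, inv_mul_mul_self hν.ne', norm_smul,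
    Real.norm_of_nonneg (inv_nonneg.2 hν.le)] at hWs
  calc ‖curl (u t) x‖ = ν * (ν⁻¹ * ‖curl (u t) x‖) := by
        rw [← mul_assoc, mul_inv_cancel₀ hν.ne', one_mul]
    _ ≤ ν * W := mul_le_mul_of_nonneg_left hWs hν.le

end Rescale

/-! ### The stub -/

/-- **Stub `stub_viscosityNormalization` of the crux `SlicedKelvin.FluxZoom`, line `registered`
(bookkeeping).** The unit-viscosity zoom statement (`stub_zoomCoreUnit`'s conclusion) implies the
general one: for `ν > 0` pass to `ũ(s, x) = ν⁻¹ u(ν⁻¹ s, x)`, `p̃ = ν⁻² p(ν⁻¹ s, ·)` on `[0, νT)`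
(`IsClassicalNSSolutionOn.viscosityRescale_set` with `Set.Ico`, `timeRescale`); the Leray–Hopf
energy inequality gives the uniform `L²` bound (`IsLerayHopfOn.lintegral_enorm_sq_le`,
`lintegral_enorm_sq_const_smul`), `curl ũ(s) = ν⁻¹ curl u(ν⁻¹ s)` (`curl_const_smul_eq`)
transports the flux bound (`M ↦ ν⁻¹ M`), the sub-slab bounds (`B ↦ ν⁻¹ B`) and the unboundedness
of the vorticity; the conclusion does not mention `u`. -/
theorem stub_viscosityNormalization :
    (∀ (T : ℝ), 0 < T →
      ∀ (u : ℝ → EuclideanSpace ℝ (Fin 3) → EuclideanSpace ℝ (Fin 3))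
        (p : ℝ → EuclideanSpace ℝ (Fin 3) → ℝ),
        Literature.Analysis.FluidPDE.IsClassicalNSSolutionOn (Set.Ico 0 T) 1 0 u p →
        (∃ K : ENNReal, K < ⊤ ∧ ∀ t ∈ Set.Ico 0 T, ∫⁻ x, ‖u t x‖ₑ ^ 2 ≤ K) →
        (∃ M : ℝ, ∀ t ∈ Set.Ico 0 T,
          ∀ (R : EuclideanSpace ℝ (Fin 3) ≃ₗᵢ[ℝ] EuclideanSpace ℝ (Fin 3)) (c : ℝ),
            ∫⁻ y : EuclideanSpace ℝ (Fin 2),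
              ‖inner ℝ (Literature.Analysis.FluidPDE.curl (u t) (R (WithLp.toLp 2 ![y 0, y 1, c])))
                (R (EuclideanSpace.single 2 1))‖ₑ ≤ ENNReal.ofReal M) →
        (∀ T' ∈ Set.Ioo 0 T, ∃ B : ℝ, ∀ t ∈ Set.Icc 0 T', ∀ x,
          ‖u t x‖ ≤ B ∧ ‖Literature.Analysis.FluidPDE.curl (u t) x‖ ≤ B) →
        (¬ ∃ W : ℝ, ∀ t ∈ Set.Ico 0 T, ∀ x, ‖Literature.Analysis.FluidPDE.curl (u t) x‖ ≤ W) →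
        ∃ (v : ℝ → EuclideanSpace ℝ (Fin 3) → EuclideanSpace ℝ (Fin 3)) (M' : ℝ),
          Literature.Analysis.FluidPDE.IsBoundedAncientMildSolution 1 v ∧
          (∀ t < 0, MeasureTheory.AEStronglyMeasurable (v t) MeasureTheory.volume) ∧
          ContDiffOn ℝ (⊤ : ℕ∞) (Function.uncurry v) (Set.Iio 0 ×ˢ Set.univ) ∧
          (∀ t < 0, ∀ (R : EuclideanSpace ℝ (Fin 3) ≃ₗᵢ[ℝ] EuclideanSpace ℝ (Fin 3)) (c : ℝ),
            ∫⁻ y : EuclideanSpace ℝ (Fin 2),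
              ‖inner ℝ (Literature.Analysis.FluidPDE.curl (v t) (R (WithLp.toLp 2 ![y 0, y 1, c])))
                (R (EuclideanSpace.single 2 1))‖ₑ ≤ ENNReal.ofReal M') ∧
          ∃ t < 0, ∃ x, Literature.Analysis.FluidPDE.curl (v t) x ≠ 0) →
    ∀ (ν T : ℝ), 0 < ν → 0 < T →
      ∀ (u : ℝ → EuclideanSpace ℝ (Fin 3) → EuclideanSpace ℝ (Fin 3))
        (p : ℝ → EuclideanSpace ℝ (Fin 3) → ℝ),
        Literature.Analysis.FluidPDE.IsClassicalNSSolutionOn (Set.Ico 0 T) ν 0 u p →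
        Literature.Analysis.FluidPDE.IsLerayHopfOn T ν 0 (u 0) u →
        Literature.Analysis.FluidPDE.HasRapidSpatialDecay (u 0) →
        (∃ M : ℝ, ∀ t ∈ Set.Ico 0 T,
          ∀ (R : EuclideanSpace ℝ (Fin 3) ≃ₗᵢ[ℝ] EuclideanSpace ℝ (Fin 3)) (c : ℝ),
            ∫⁻ y : EuclideanSpace ℝ (Fin 2),
              ‖inner ℝ (Literature.Analysis.FluidPDE.curl (u t) (R (WithLp.toLp 2 ![y 0, y 1, c])))
                (R (EuclideanSpace.single 2 1))‖ₑ ≤ ENNReal.ofReal M) →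
        (∀ T' ∈ Set.Ioo 0 T, ∃ B : ℝ, ∀ t ∈ Set.Icc 0 T', ∀ x,
          ‖u t x‖ ≤ B ∧ ‖Literature.Analysis.FluidPDE.curl (u t) x‖ ≤ B) →
        (¬ ∃ W : ℝ, ∀ t ∈ Set.Ico 0 T, ∀ x, ‖Literature.Analysis.FluidPDE.curl (u t) x‖ ≤ W) →
        ∃ (v : ℝ → EuclideanSpace ℝ (Fin 3) → EuclideanSpace ℝ (Fin 3)) (M' : ℝ),
          Literature.Analysis.FluidPDE.IsBoundedAncientMildSolution 1 v ∧
          (∀ t < 0, MeasureTheory.AEStronglyMeasurable (v t) MeasureTheory.volume) ∧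
          ContDiffOn ℝ (⊤ : ℕ∞) (Function.uncurry v) (Set.Iio 0 ×ˢ Set.univ) ∧
          (∀ t < 0, ∀ (R : EuclideanSpace ℝ (Fin 3) ≃ₗᵢ[ℝ] EuclideanSpace ℝ (Fin 3)) (c : ℝ),
            ∫⁻ y : EuclideanSpace ℝ (Fin 2),
              ‖inner ℝ (Literature.Analysis.FluidPDE.curl (v t) (R (WithLp.toLp 2 ![y 0, y 1, c])))
                (R (EuclideanSpace.single 2 1))‖ₑ ≤ ENNReal.ofReal M') ∧
          ∃ t < 0, ∃ x, Literature.Analysis.FluidPDE.curl (v t) x ≠ 0 := by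
  intro hunit ν T hν hT u p hcl hLH _ hflux hsub hunb
  obtain ⟨M, hM⟩ := hflux
  exact hunit (ν * T) (mul_pos hν hT) (timeRescale ν⁻¹ ν⁻¹ u) (timeRescale ν⁻¹ (ν⁻¹ ^ 2) p)
    (isClassical_timeRescale_Ico hcl hν) (energy_timeRescale_Ico hν hLH)
    ⟨ν⁻¹ * M, flux_timeRescale_Ico hcl hν hM⟩ (subslab_timeRescale_Ico hcl hν hsub)
    (unbounded_timeRescale_Ico hcl hν hunb)

end Summit.NavierStokesRegularity.NavierStokesRegularity.Theorems.FluxZoom.Registered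

end
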